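import Literature.NumberTheory.EllipticCurves.YanZhu2026.GreenbergMainTheoremsAnyRootGuarded
import Literature.NumberTheory.EllipticCurves.YanZhu2026.HidaRankinLFunctionExistence
import Literature.NumberTheory.EllipticCurves.BurungaleSkinnerTianWan2024.SignedTwoVariableDescentPackagePRE
import Summits.BirchSwinnertonDyer.BirchSwinnertonDyer.Theorems.SignedBaseChangeTwistPairGreenbergProductDivisibilityStubFrameData
import Summits.BirchSwinnertonDyer.Rank1Residual.Partition.IrreducibleOverQuadraticField
import HarnessLib

/-!
# The anticyclotomic Eisenstein crux `AnticyclotomicEisensteinDivisibility` (stmt-BirchSwinnertonDyer-20727,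
# child of K1″ along `acanchor`, route SignedBaseChange): its GOOD ORDINARY slice, BY NAME, from refereed print

Lead prover sbc-p1 g6 (2026-08-27), line `bdpline` (registered on 20727). The crux asks, for a good prime
`p ≥ 5` with `ρ̄_{E,p}` surjective, a Heegner field `K` with `p` split and EVERY Katz/Greenberg frame
`(LK, G)` with genuine period data, that the constant-in-`T₁` coefficient of `ch(X_Gr(E/K_∞))·𝒪_{ℂ_p}⟦T₁,T₂⟧`
lies in `(G⁻)`, `G⁻ = UnrSeries₂.minus G = constantCoeff G`.

OBSERVATION (this file): the crux is the image under the ring map `constantCoeff : 𝒪⟦T₁⟧⟦T₂⟧ → 𝒪⟦T₂⟧`… of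
the TWO-variable Eisenstein inclusion `ch(X_Gr(E/K_∞))·𝒪⟦T₁,T₂⟧ ⊆ (G)`; `Ideal.map` is monotone and maps
`(G)` to `(G⁻)`. At a good ORDINARY prime the two-variable inclusion is refereed print — Yan–Zhu 2026
Thm. 4.2 (2) (tree fact `YanZhu2026.thm42_XGr₂_isTorsion_charIdeal_le_greenbergAnyRoot`, an `∃`-frame
statement: torsion of `X_Gr` and the inclusion for ONE Katz/Greenberg frame) — and it is moved to EVERY
frame with genuine period data by the Beilinson–Flach equivalence Yan–Zhu Thm. 4.7 (guarded tree fact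
`thm47_ord_localised_iff_greenbergAnyRoot_localised_guarded`, at `S = {1}`), which compares each Greenberg
frame with the frame-independent ordinary side `Char(X_ord) ⊂ (𝓛_p^PR)`; the type-I frame it needs is
Yan–Zhu Thm. 3.3 (`thm33_exists_isHidaRankinLFunction`), the modular parametrisation is the crux's own
antecedent (`π.f = f` by `IsNewformOf.unique`), (irr_K) in both spellings comes from (sur)
(`irrK_of_surj`, `irrK_framed_of_surj`).

RESULTS (conditional on the three named refereed facts, taken as hypotheses; nothing asserted):
* `charIdealXGr₂_map_le_span_of_goodOrd` — the two-variable Eisenstein inclusion for EVERY frame at a good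
  ordinary prime (the ∀-frame form the crux quantifies over);
* `xGr₂_isTorsion_of_goodOrd` — the GoodOrd slice of the registered stub `stub_xGrIsTorsion` (S0);
* `acDivChild_of_goodOrd` — the text of stmt-BirchSwinnertonDyer-20727 with `GoodOrd W p →` inserted after
  `W.HasGoodReductionAtPrime p →`: the ORDINARY slice of the crux is PRINT (no specialisation stub S2, no BDP
  currency needed). Hence the crux's open content is exactly its supersingular slice (`a_p = 0`; line
  `bdpline`: S0/S1/S2/S3 there), in accordance with the route (X7 pairs are supersingular).
No new definitions; the route file is not imported (the crux text is restated with the extra binder).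
-/

-- D-0017: single-problem summit, the namespace repeats the problem name by design.
set_option linter.dupNamespace false
set_option autoImplicit false

noncomputable section

open scoped Classical

namespace Summit.BirchSwinnertonDyer.BirchSwinnertonDyer.Theorems.SignedBaseChangeAcDivOrdinary

open NumberField IsDedekindDomain Field CongruenceSubgroup
  Literature.NumberTheory.GaloisRepresentations Literature.NumberTheory.EllipticCurves
  Literature.NumberTheory.EllipticCurves.ModularForms Literature.NumberTheory.EllipticCurves.Rank1Residual
  Literature.NumberTheory.EllipticCurves.YanZhu2026 Literature.NumberTheory.EllipticCurves.IwasawaAlgebra₂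

variable {p : ℕ} [Fact p.Prime]

/-- **The two-variable Greenberg Eisenstein inclusion at a good ORDINARY prime, for EVERY Katz/Greenberg
frame with genuine period data** (`ch(X_Gr(E/K_∞))·𝒪_{ℂ_p}⟦T₁,T₂⟧ ⊆ (G)` along every structure map
`J`), for `E/ℚ` globally minimal with newform `f` of level `N = N_E`, `p ≥ 5` good ordinary with
`ρ̄_{E,p}` surjective, `K` imaginary quadratic of Heegner type for `N` with `p = v v̄` split (`v` induced by
`ι`), `(N, D_K) = 1`, `D_K` odd, `≠ −3`, and the cyclotomic/anticyclotomic tower with an adapted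
generator pair — from Yan–Zhu Thm. 4.2 (2) (one frame), Thm. 4.7 (guarded; transport through the
ordinary side at `S = {1}`) and Thm. 3.3 (a type-I frame), with a modular parametrisation of `E`.
[cite: YanZhu2024MainConjNonCM, Thm. 4.2 (2), Thm. 4.7, Thm. 3.3 (arXiv:2412.20078v4 TeX l.932–940, l.1022–1034, l.738–752)] -/
theorem charIdealXGr₂_map_le_span_of_goodOrd
    (h42 : thm42_XGr₂_isTorsion_charIdeal_le_greenbergAnyRoot)
    (h47 : thm47_ord_localised_iff_greenbergAnyRoot_localised_guarded)
    (h33 : thm33_exists_isHidaRankinLFunction)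
    (hmodP : nonempty_modularParametrizationData)
    (ι : PadicAlgCl p ≃+* ℂ) (W : WeierstrassCurve ℚ) [W.IsElliptic] [W.IsGloballyMinimal]
    (hp : 5 ≤ p) (hord : GoodOrd W p) (hs : Surj W p)
    (K : Type) [Field K] [NumberField K] (v vbar : HeightOneSpectrum (𝓞 K))
    (κ₁ κ₂ : ZpExtension K p) (γ₁ γ₂ : absoluteGaloisGroup K)
    [Fact (ZpExtension.IsTopGeneratorPair κ₁ κ₂ γ₁ γ₂)] [NeZero (NumberField.discr K).natAbs]
    {N : ℕ} [NeZero N] {f : CuspForm (Gamma0 N) 2} (hf : IsNewformOf W f)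
    (hN : (N : ℤ) = W.conductorNorm ℤ) (hK : IsImaginaryQuadratic K)
    (hsplit : ((Ideal.span {(p : ℤ)}).primesOver (𝓞 K)).ncard = 2)
    (hv : ((p : ℕ) : 𝓞 K) ∈ v.asIdeal) (hvbar : ((p : ℕ) : 𝓞 K) ∈ vbar.asIdeal) (hvv : vbar ≠ v)
    (hι : ∀ (w : InfinitePlace K) (k : 𝓞 K), k ∈ v.asIdeal ↔ ‖ι.symm (w.embedding (k : K))‖ < 1)
    (hcop : IsCoprime (N : ℤ) (NumberField.discr K))
    (hHeeg : ∀ ℓ : ℕ, ℓ.Prime → ℓ ∣ N → ((Ideal.span {(ℓ : ℤ)}).primesOver (𝓞 K)).ncard = 2)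
    (hodd : Odd (NumberField.discr K)) (hne3 : NumberField.discr K ≠ -3)
    (hκ₁ : κ₁.IsCyclotomic) (hκ₂ : κ₂.IsAnticyclotomic)
    {Ω δ : ℂ} {Ωp : (unrIntegers p)ˣ} {LK G : PowerSeries (PowerSeries (PadicComplexInt p))}
    (hΩ : Ω ≠ 0) (hδ : δ ^ 2 = (NumberField.discr K : ℂ) ∨ δ ^ 2 = -(NumberField.discr K : ℂ))
    (hLK : IsKatzMeasure₂ ι v vbar ∅ κ₁ κ₂ γ₁⁻¹ γ₂⁻¹ 1 Ω δ ((Ωp : unrIntegers p) : ℂ_[p]) LK)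
    (hG : IsGreenbergLFunctionAnyRoot₂ ι v vbar κ₁ κ₂ γ₁⁻¹ γ₂⁻¹ f (NumberField.discr K).natAbs
      (NumberField.classNumber K) LK G)
    (J : ℤ_[p] →+* PadicComplexInt p)
    (hJ : ∀ x : ℤ_[p], ((J x : PadicComplexInt p) : ℂ_[p]) = ((x : ℚ_[p]) : ℂ_[p])) :
    (WeierstrassCurve.XGr₂.charIdeal (W.baseChange K) p κ₁ κ₂ vbar γ₁ γ₂).map (toUnr₂ p J) ≤
      Ideal.span {G} := by
  have hp2 : p ≠ 2 := by omega
  have hset : GreenbergSetting ι W N K v vbar κ₁ κ₂ :=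
    ⟨hN, by omega, hord, hK, hsplit, hv, hvbar, hvv, hι, hcop, hodd, hne3, hκ₁, hκ₂⟩
  have habs : ∀ ρ : ModPGaloisRep K (ZMod p) 2, (W.baseChange K).IsTorsionGaloisRep p ρ →
      FramedRep.IsAbsolutelyIrreducible ρ :=
    fun ρ hρ ↦ SignedBaseChangeK1FrameData.irrK_framed_of_surj W p hp2 hs K hK.1 ρ hρ
  have hirr : (W.baseChange K).HasIrreducibleModPGaloisRep p :=
    Summit.BirchSwinnertonDyer.Rank1Residual.irrK_of_surj W p hs K hK.1
  -- Yan–Zhu Thm. 4.2 (2): ONE frame `(LK₀, G₀)` with the inclusion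
  obtain ⟨Ω₀, δ₀, Ωp₀, LK₀, G₀, hΩ₀, hδ₀, hLK₀, hG₀, -, hJ₀⟩ :=
    h42 ι W K v vbar κ₁ κ₂ γ₁ γ₂ hf hset hHeeg habs
  have hle₀ := (hJ₀ J hJ).1
  -- the modular parametrisation, with `π.f = f`
  have hNn : N = W.conductorNorm ℤ := by exact_mod_cast hN
  subst hNn
  obtain ⟨π⟩ := hmodP W
  have hπf : π.f = f := π.isNewformOf.unique hf
  -- the embedding `ℤ̄ ⊂ ℂ → ℚ̄_p ⊂ ℂ_p` induced by `ι` (the `ι₁` of the type-I frames), compatible with `ι`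
  let ι₁ : integralClosure ℚ ℂ →+* ℂ_[p] := (algebraMap (PadicAlgCl p) ℂ_[p]).comp
    ((ι.symm : ℂ ≃+* PadicAlgCl p).toRingHom.comp (algebraMap (integralClosure ℚ ℂ) ℂ))
  have hι₁ : ∀ z : integralClosure ℚ ℂ, ι₁ z = ((ι.symm (z : ℂ) : PadicAlgCl p) : ℂ_[p]) := fun _ ↦ rfl
  -- a type-I frame (Thm. 3.3) along `ι₁`
  obtain ⟨F, hF, hcF⟩ := h33 ι₁ W K κ₁ κ₂ γ₁ γ₂ π.isNewformOf hN (by omega) hord hK hsplit hcop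
  rw [← hπf] at hG₀ hG
  -- Thm. 4.7 at `S = {1}`: frame 0 ⟹ ordinary side ⟹ the given frame
  have h0 := (h47 ι₁ ι W K v vbar κ₁ κ₂ γ₁ γ₂ π hset hirr hι₁ F hF hcF
    Ω₀ δ₀ Ωp₀ LK₀ G₀ hΩ₀ hδ₀ hLK₀ hG₀ J hJ 1 one_ne_zero).1
  have hordSide := h0.mpr ⟨0, by simpa using hle₀⟩
  have h1 := (h47 ι₁ ι W K v vbar κ₁ κ₂ γ₁ γ₂ π hset hirr hι₁ F hF hcF
    Ω δ Ωp LK G hΩ hδ hLK hG J hJ 1 one_ne_zero).1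
  obtain ⟨n, hn⟩ := h1.mp hordSide
  simpa using hn

/-- **`X_Gr(E/K_∞)` is `Λ_K`-torsion at a good ORDINARY prime** — the GoodOrd slice of the registered stub
`stub_xGrIsTorsion` (S0) of line `bdpline` on stmt-BirchSwinnertonDyer-20727 (its text with the antecedent
`SignedTwoVariableInputs` by value and `GoodOrd W p →` inserted after `W.HasGoodReductionAtPrime p →`), from
Yan–Zhu Thm. 4.2 (2), torsion clause. [cite: YanZhu2024MainConjNonCM, Thm. 4.2 (2), torsion clause (arXiv:2412.20078v4 TeX l.939–940)] -/
theorem xGr₂_isTorsion_of_goodOrd (h42 : thm42_XGr₂_isTorsion_charIdeal_le_greenbergAnyRoot) :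
    (Literature.NumberTheory.EllipticCurves.BurungaleCastellaSkinner2025.prop422_greenbergAnyRoot_hasUnitContent_minus ∧ Literature.NumberTheory.EllipticCurves.BurungaleSkinnerTianWan2024.props118_27_519_exists_signedTwoVariablePackage_supersingular_PRE) → Literature.NumberTheory.EllipticCurves.ModularForms.nonempty_modularParametrizationData → ∀ (W : WeierstrassCurve ℚ) [W.IsElliptic] [W.IsGloballyMinimal] (p : ℕ) [Fact p.Prime], 5 ≤ p → W.HasGoodReductionAtPrime p → Literature.NumberTheory.EllipticCurves.Rank1Residual.GoodOrd W p → Literature.NumberTheory.EllipticCurves.Rank1Residual.Surj W p → ∀ (K : Type) [Field K] [NumberField K] (ι : PadicAlgCl p ≃+* ℂ) (v vbar : IsDedekindDomain.HeightOneSpectrum (NumberField.RingOfIntegers K)) (κ₁ κ₂ : Literature.NumberTheory.EllipticCurves.ZpExtension K p) (γ₁ γ₂ : Field.absoluteGaloisGroup K) [Fact (Literature.NumberTheory.EllipticCurves.ZpExtension.IsTopGeneratorPair κ₁ κ₂ γ₁ γ₂)] [NeZero (NumberField.discr K).natAbs] (N : ℕ) [NeZero N] (f : CuspForm (CongruenceSubgroup.Gamma0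 N) 2), Literature.NumberTheory.EllipticCurves.ModularForms.IsNewformOf W f → (N : ℤ) = W.conductorNorm ℤ → Literature.NumberTheory.EllipticCurves.IsImaginaryQuadratic K → ((Ideal.span {(p : ℤ)}).primesOver (NumberField.RingOfIntegers K)).ncard = 2 → ((p : ℕ) : NumberField.RingOfIntegers K) ∈ v.asIdeal → ((p : ℕ) : NumberField.RingOfIntegers K) ∈ vbar.asIdeal → vbar ≠ v → (∀ (w : NumberField.InfinitePlace K) (k : NumberField.RingOfIntegers K), k ∈ v.asIdeal ↔ ‖ι.symm (w.embedding (k : K))‖ < 1) → IsCoprime (N : ℤ) (NumberField.discr K) → (∀ ℓ : ℕ, ℓ.Prime → ℓ ∣ N → ((Ideal.span {(ℓ : ℤ)}).primesOver (NumberField.RingOfIntegers K)).ncard = 2) → Odd (NumberField.discr K) → NumberField.discr K ≠ -3 → κ₁.IsCyclotomic → κ₂.IsAnticyclotomic → Module.IsTorsion (Literature.NumberTheory.EllipticCurves.IwasawaAlgebra₂ p) ((W.baseChange K).XGr₂ p κ₁ κ₂ vbar γ₁ γ₂) := by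
  intro _ _ W _ _ p _ hp _ hord hs K _ _ ι v vbar κ₁ κ₂ γ₁ γ₂ _ _ N _ f hf hN hK hsplit hv hvbar hvv hι
    hcop hHeeg hodd hne3 hκ₁ hκ₂
  have hp2 : p ≠ 2 := by omega
  have hset : GreenbergSetting ι W N K v vbar κ₁ κ₂ :=
    ⟨hN, by omega, hord, hK, hsplit, hv, hvbar, hvv, hι, hcop, hodd, hne3, hκ₁, hκ₂⟩
  have habs : ∀ ρ : ModPGaloisRep K (ZMod p) 2, (W.baseChange K).IsTorsionGaloisRep p ρ →
      FramedRep.IsAbsolutelyIrreducible ρ :=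
    fun ρ hρ ↦ SignedBaseChangeK1FrameData.irrK_framed_of_surj W p hp2 hs K hK.1 ρ hρ
  obtain ⟨-, -, -, -, -, -, -, -, -, htors, -⟩ := h42 ι W K v vbar κ₁ κ₂ γ₁ γ₂ hf hset hHeeg habs
  exact htors

/-- **The ORDINARY slice of the crux `AnticyclotomicEisensteinDivisibility` (stmt-BirchSwinnertonDyer-20727)
is refereed print**: its text VERBATIM with `GoodOrd W p →` inserted after `W.HasGoodReductionAtPrime p →`,
from Yan–Zhu 2026 Thm. 4.2 (2) + Thm. 4.7 (guarded) + Thm. 3.3 — apply `Ideal.map constantCoeff` to the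
two-variable inclusion `charIdealXGr₂_map_le_span_of_goodOrd`; `(G).map constantCoeff = (G⁻)`. The
published-inputs antecedent is not used. [cite: YanZhu2024MainConjNonCM, Thm. 4.2 (2), Thm. 4.7, Thm. 3.3 (arXiv:2412.20078v4)] -/
theorem acDivChild_of_goodOrd
    (h42 : thm42_XGr₂_isTorsion_charIdeal_le_greenbergAnyRoot)
    (h47 : thm47_ord_localised_iff_greenbergAnyRoot_localised_guarded)
    (h33 : thm33_exists_isHidaRankinLFunction) :
    (Literature.NumberTheory.EllipticCurves.BurungaleCastellaSkinner2025.prop422_greenbergAnyRoot_hasUnitContent_minus ∧ Literature.NumberTheory.EllipticCurves.BurungaleSkinnerTianWan2024.props118_27_519_exists_signedTwoVariablePackage_supersingular_PRE) → Literature.NumberTheory.EllipticCurves.ModularForms.nonempty_modularParametrizationData → ∀ (W : WeierstrassCurve ℚ) [W.IsElliptic] [W.IsGloballyMinimal] (p : ℕ) [Fact p.Prime], 5 ≤ p → W.HasGoodReductionAtPrime p → Literature.NumberTheory.EllipticCurves.Rank1Residual.GoodOrd W p → Literature.NumberTheory.EllipticCurves.Rank1Residual.Surj W p → ∀ (K :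 Type) [Field K] [NumberField K] (ι : PadicAlgCl p ≃+* ℂ) (v vbar : IsDedekindDomain.HeightOneSpectrum (NumberField.RingOfIntegers K)) (κ₁ κ₂ : Literature.NumberTheory.EllipticCurves.ZpExtension K p) (γ₁ γ₂ : Field.absoluteGaloisGroup K) [Fact (Literature.NumberTheory.EllipticCurves.ZpExtension.IsTopGeneratorPair κ₁ κ₂ γ₁ γ₂)] [NeZero (NumberField.discr K).natAbs] (N : ℕ) [NeZero N] (f : CuspForm (CongruenceSubgroup.Gamma0 N) 2), Literature.NumberTheory.EllipticCurves.ModularForms.IsNewformOf W f → (N : ℤ) = W.conductorNorm ℤ → Literature.NumberTheory.EllipticCurves.IsImaginaryQuadratic K → ((Ideal.span {(p : ℤ)}).primesOver (NumberField.RingOfIntegers K)).ncard = 2 → ((p : ℕ) : NumberField.RingOfIntegers K) ∈ v.asIdeal → ((p : ℕ) : NumberField.RingOfIntegers K) ∈ vbar.asIdeal → vbar ≠ v → (∀ (w : NumberField.InfinitePlace K) (k : NumberField.RingOfIntegers K), k ∈ v.asIdeal ↔ ‖ι.symm (w.embedding (k : K))‖ < 1) → IsCoprime (N : ℤ) (NumberField.discr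 K) → (∀ ℓ : ℕ, ℓ.Prime → ℓ ∣ N → ((Ideal.span {(ℓ : ℤ)}).primesOver (NumberField.RingOfIntegers K)).ncard = 2) → Odd (NumberField.discr K) → NumberField.discr K ≠ -3 → κ₁.IsCyclotomic → κ₂.IsAnticyclotomic → ∀ (Ω δ : ℂ) (Ωp : (Literature.NumberTheory.EllipticCurves.unrIntegers p)ˣ) (LK G : PowerSeries (PowerSeries (PadicComplexInt p))), Ω ≠ 0 → (δ ^ 2 = (NumberField.discr K : ℂ) ∨ δ ^ 2 = -(NumberField.discr K : ℂ)) → Literature.NumberTheory.EllipticCurves.IsKatzMeasure₂ ι v vbar ∅ κ₁ κ₂ γ₁⁻¹ γ₂⁻¹ 1 Ω δ ((Ωp : Literature.NumberTheory.EllipticCurves.unrIntegers p) : PadicComplex p) LK → Literature.NumberTheory.EllipticCurves.IsGreenbergLFunctionAnyRoot₂ ι v vbar κ₁ κ₂ γ₁⁻¹ γ₂⁻¹ f (NumberField.discr K).natAbs (NumberField.classNumber K) LK G → ∀ J : ℤ_[p] →+* PadicComplexInt p, (∀ x : ℤ_[p], ((J x : PadicComplexInt p) : PadicComplex p) = ((x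 : ℚ_[p]) : PadicComplex p)) → ((WeierstrassCurve.XGr₂.charIdeal (W.baseChange K) p κ₁ κ₂ vbar γ₁ γ₂).map (Literature.NumberTheory.EllipticCurves.IwasawaAlgebra₂.toUnr₂ p J)).map (PowerSeries.constantCoeff (R := PowerSeries (PadicComplexInt p))) ≤ Ideal.span {Literature.NumberTheory.EllipticCurves.UnrSeries₂.minus G} := by
  intro _ hmodP W _ _ p _ hp _ hord hs K _ _ ι v vbar κ₁ κ₂ γ₁ γ₂ _ _ N _ f hf hN hK hsplit hv hvbar hvv hι
    hcop hHeeg hodd hne3 hκ₁ hκ₂ Ω δ Ωp LK G hΩ hδ hLK hG J hJ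
  have hle := charIdealXGr₂_map_le_span_of_goodOrd h42 h47 h33 hmodP ι W hp hord hs K v vbar κ₁ κ₂ γ₁ γ₂
    hf hN hK hsplit hv hvbar hvv hι hcop hHeeg hodd hne3 hκ₁ hκ₂ hΩ hδ hLK hG J hJ
  refine (Ideal.map_mono hle).trans (le_of_eq ?_)
  rw [Ideal.map_span, Set.image_singleton]
  rfl

end Summit.BirchSwinnertonDyer.BirchSwinnertonDyer.Theorems.SignedBaseChangeAcDivOrdinary

end
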